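import Literature.NumberTheory.Automorphic.ShimuraCurveRibetTakahashi
import Literature.NumberTheory.DiophantineGeometry.PastenValuationProductsManyPrimesProofs
import Literature.NumberTheory.EllipticCurves.PastenValuationProductThm115FromThm161Proofs
import Literature.NumberTheory.EllipticCurves.PastenValuationProductStrict
import HarnessLib

/-!
# Pasten's bounds for `∏_{p ∣ D} v_p(Δ_E)` over an admissible factorisation `N_E = D M`
# (Theorems 16.1 and 16.4 of *Shimura curves and the abc conjecture*)

Named facts (CONVENTIONS §4: `def … : Prop`, cite-tagged, typed ≠ proved) from
H. Pasten, *Shimura curves and the abc conjecture*, J. Number Theory **254** (2024) 214–335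
= arXiv:1705.09251v4 (held TeX, READ: §2 p. 12 "admissible", §3 p. 13 "Frey–Hellegouarch",
§16.1 Theorem 16.1 with its proof p. 49, §16.2 Theorem 16.4 with its proof p. 50; arXiv numbering,
as in every sibling file), the two theorems of §16 that the tree did not yet declare:

* `pastenShimura2024_thm_16_1` — **Theorem 16.1** ("A general estimate for elliptic curves"):
  for `S` finite and `ε > 0`, for all but finitely many `E/ℚ` semi-stable away from `S` and every
  admissible `N_E = D M` (with `D` supported away from `S`), `∏_{p ∣ D} v_p(Δ_E) < N_E^{11/3+ε}`.
* `pastenShimura2024_thm_16_4` — **Theorem 16.4** ("A sharpening of the general estimate"): for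
  `ε > 0` and `E/ℚ` of conductor `N ≫_ε 1`, `N = D M` admissible, if (i) `E` is semi-stable and `M`
  is not prime, or (ii) `E` is a Frey–Hellegouarch curve and `M` is divisible by at least two odd
  primes, then `∏_{p ∣ D} v_p(Δ) < N^{8/3+ε} M`.

Both are PROVED IN PRINT (refereed, JNT 2024) by the paper's Shimura-curve engine — the refined
Ribet–Takahashi formula Thm 6.1 (a)/(b) (tree facts `PastenShimura2024_thm_6_1`/`_thm_6_1_b`),
Jacquet–Langlands parametrisations `X₀^D(M) → A_{D,M}` (`nonempty_shimuraParametrizationData`),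
Frey's identity (PROVED, `zagier_degree_formula_holds`; quaternionic twin
`normSq_form_eq_deg_mul_covolume`), Mazur–Kenku, the newform bound `‖f‖² ≪ N log N`
(`murty_petersson_newform_upper_bound`), the Manin-constant bound Cor 10.2
(`PastenShimura2024_cor_10_2`) and the Arakelov lower bound Thm 14.1 for integral quaternionic forms
(no declaration in the tree) — none of it in Mathlib, so they are vendored as named facts and NOT
proved here. Until now both entered the tree only as INLINE HYPOTHESES (`h161` of
`PastenCor162FromThm161Proofs` / `PastenValuationProductThm115FromThm161Proofs`; `h164` of
`ValuationProductEllipticManyPrimesProofs` / `PastenValuationProductsManyPrimesProofs` /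
`PastenValuationProductStrict`, semi-stable case (i) only); case (ii) — the one the `abc` theorem
(arXiv Thm 16.7 = JNT Thm 16.8 = tree `pasten2024_thm_2_5`) consumes — had no carrier at all.

## Rendering (the reviewer's checklist)

* `E/ℚ` = any elliptic `W : WeierstrassCurve ℚ` (all quantities are `ℚ`-isomorphism invariants);
  `N_E = W.conductorNorm ℤ`; `v_p(Δ_E) = (W.minimalDiscriminantNorm ℤ).factorization p` (exponent of
  `p` in `|Δ_min|`) — the idiom of `PastenValuationProducts` / `ValuationProductElliptic`.
* "admissible factorization `N = DM`" (§2 p. 12: "`D, M` are coprime positive integers with `D`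
  being the product of an even number of distinct prime factors, possibly `D = 1`") = the tree's
  `Literature.NumberTheory.Automorphic.IsAdmissibleFactorization N D M` (`ShimuraCurve.lean`).
* "semi-stable away from `S`" = `p² ∤ N_E` for primes `p ∉ S` (idiom of `pastenShimura2024_cor_16_2`,
  `pasten_valuationProduct_awayFrom`, `PastenShimura2024_cor_10_2`); "semi-stable" =
  `W.IsSemistable ℤ`; "Frey–Hellegouarch elliptic curve" (§3 p. 13) =
  `Literature.NumberTheory.Automorphic.IsFreyHellegouarch W`; "`M` divisible by at least two odd
  primes" = `2 ≤ (M.primeFactors.erase 2).card`; "`M` is not a prime number" = `¬ M.Prime` — all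
  four exactly as the tree's `PastenShimura2024_thm_6_1_b` renders the same classes (b.1)/(b.2).
* "for all but finitely many `E`" (Thm 16.1) / "of conductor `N ≫_ε 1`" (Thm 16.4) = a conductor
  threshold `N_E ≥ N₀` depending only on `(S, ε)` resp. `ε` (p. 12: "We will be willing to discard
  finitely many (isomorphism classes of) elliptic curves …, which is the same as letting `N` be large
  enough, by Shafarevich's theorem"). For Thm 16.1 the threshold form FOLLOWS from the printed one
  (the finitely many exceptions have bounded conductor) — WEAKER-trivially; for Thm 16.4 it is verbatim.
* Thm 16.1's parenthetical "(in particular, `D` is supported away from `S`)" is kept as a HYPOTHESIS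
  on `D` (`∀ p ∈ D.primeFactors, p ∉ S`), which can only weaken the statement — exactly the reading
  of the tree's `h161`.
* Real powers `Real.rpow`; exponents written `(11 : ℝ)/3 + ε`, `(8 : ℝ)/3 + ε` (syntactically the
  `h161`/`h164` terms).

## API (proved here)

* `isAdmissibleFactorization_div`, `isAdmissibleFactorization_div_of_squarefree`,
  `IsAdmissibleFactorization.right_eq_div` — the dictionary between `IsAdmissibleFactorization N D M`
  and the inline idiom "`D ∣ N`, `gcd(D, N/D) = 1`, `D` squarefree, `ω(D)` even, `M = N/D`".
* `pastenShimura2024_thm_16_1_iff_h161` — the fact is EQUIVALENT to the tree's inline hypothesis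
  `h161` (so the rendering adds and loses nothing relative to what the tree already consumed);
  `pastenShimura2024_thm_16_4.isSemistable` / `.squarefree` — case (i) in the two inline `h164`
  shapes; `pastenShimura2024_thm_16_4.freyHellegouarch` — case (ii).
* The consumers, now fed BY NAME: `pasten_cor_16_2_of_pastenShimura2024_thm_16_1` (Cor 16.2),
  `pasten_thm_1_15_of_pastenShimura2024_thm_16_1` (Thm 1.15, Tamagawa),
  `pasten_valuationProduct_semistable_manyPrimes_strict_of_pastenShimura2024_thm_16_4` (Thm 16.5,
  second part, strict form), `pasten_thm_1_12_strict_of_pastenShimura2024_thm_16_1_16_4` (Thm 1.12 /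
  16.5 corrected form ⇐ 16.1 + Mestre–Oesterlé + 16.4).

## What is NOT here

The proof of either theorem (Shimura-curve engine, above); Thm 6.1 (a) as a separate fact (typed
elsewhere only for (b)); the effectivity remarks; Theorem 16.7 (`abc`), which is DERIVED from
`pastenShimura2024_thm_16_4` (ii) in the sibling proofs file `AbcValuationProductShimuraProofs`.

## References

* [PastenShimura2024] H. Pasten, *Shimura curves and the abc conjecture*, J. Number Theory 254
  (2024) 214–335, doi:10.1016/j.jnt.2023.07.002 = arXiv:1705.09251v4 — §2 p. 12, §3 p. 13,
  Theorem 16.1 (p. 49), Theorem 16.4 (p. 50).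
-/

noncomputable section

open Finset

namespace Literature.NumberTheory.DiophantineGeometry

open Literature.NumberTheory.Automorphic (IsAdmissibleFactorization IsFreyHellegouarch)

/-! ### Admissible factorisations: the dictionary with the inline idiom -/

/-- `N = D · (N/D)` is admissible as soon as `N > 0`, `D ∣ N`, `gcd(D, N/D) = 1`, `D` is squarefree
and `ω(D)` is even (the inline idiom of `PastenCor162FromThm161Proofs`) — Pasten's definition
§2 p. 12 unfolded. [cite: PastenShimura2024, §2 p. 12 (admissible factorization)] -/
theorem isAdmissibleFactorization_div {N D : ℕ} (hN : 0 < N) (hD : D ∣ N)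
    (hcop : D.Coprime (N / D)) (hsq : Squarefree D) (heven : Even D.primeFactors.card) :
    IsAdmissibleFactorization N D (N / D) :=
  ⟨hN, Nat.mul_div_cancel' hD, hsq, heven, hcop⟩

/-- For squarefree `N`, every divisor `D` with `ω(D)` even gives an admissible `N = D · (N/D)`
(the inline idiom of `ValuationProductEllipticManyPrimesProofs`): `N = D · (N/D)` squarefree
forces `gcd(D, N/D) = 1` and `D` squarefree. [cite: PastenShimura2024, §2 p. 12 (admissible factorization)] -/
theorem isAdmissibleFactorization_div_of_squarefree {N D : ℕ} (hN : Squarefree N) (hD : D ∣ N)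
    (heven : Even D.primeFactors.card) : IsAdmissibleFactorization N D (N / D) := by
  obtain ⟨k, rfl⟩ := hD
  have hD0 : D ≠ 0 := fun h => hN.ne_zero (by rw [h, zero_mul])
  obtain ⟨hcop, hsqD, -⟩ := Nat.squarefree_mul_iff.mp hN
  have hk : D * k / D = k := Nat.mul_div_cancel_left k (Nat.pos_of_ne_zero hD0)
  refine ⟨Nat.pos_of_ne_zero hN.ne_zero, by rw [hk], hsqD, heven, by rwa [hk]⟩

/-- In an admissible factorisation `N = D M` one has `M = N / D` (dot-notation extension of the
structure of `Literature/NumberTheory/Automorphic/ShimuraCurve.lean`, declared with its absolute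
name; Pasten §2 p. 12: "`D, M` are coprime positive integers" with `N = DM`). [cite: PastenShimura2024, §2 p. 12 (admissible factorization)] -/
theorem _root_.Literature.NumberTheory.Automorphic.IsAdmissibleFactorization.right_eq_div {N D M : ℕ} (h : IsAdmissibleFactorization N D M) :
    M = N / D := by
  rw [← h.mul_eq, Nat.mul_div_cancel_left M h.pos_left]

/-- In an admissible factorisation `N = D M` one has `D ∣ N` (dot-notation extension, absolute
name). [cite: PastenShimura2024, §2 p. 12 (admissible factorization)] -/
theorem _root_.Literature.NumberTheory.Automorphic.IsAdmissibleFactorization.left_dvd {N D M : ℕ} (h : IsAdmissibleFactorization N D M) :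
    D ∣ N :=
  ⟨M, h.mul_eq.symm⟩

/-! ### Theorem 16.1 -/

/-- NAMED FACT — **Pasten, J. Number Theory 254 (2024), Theorem 16.1** (arXiv:1705.09251v4 §16.1,
p. 49, "A general estimate for elliptic curves"). Printed statement: "Let `S` be a finite set of
primes and let `ε > 0`. For all but finitely many elliptic curves `E/ℚ` semi-stable away from `S`,
the following holds: Let `N = N_E` be the conductor of `E` and let `Δ_E` be the minimal discriminant
of `E`. Consider an admissible factorization `N = DM` (in particular, `D` is supported away from
`S`). Then `∏_{p ∣ D} v_p(Δ_E) < N^{11/3 + ε}`." Rendering (module docstring): `E` = any elliptic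
`W/ℚ`; semi-stable away from `S` = `p² ∤ N_E` for primes `p ∉ S`; "all but finitely many" = a
threshold `N_E ≥ N₀(S, ε)` (follows from the printed form: the exceptions have bounded conductor);
admissible = `IsAdmissibleFactorization N_E D M`; the parenthetical kept as the hypothesis
`∀ p ∈ D.primeFactors, p ∉ S`; `v_p(Δ_E)` = exponent of `p` in `|Δ_min|`. Equivalent to the inline
hypothesis `h161` of `PastenCor162FromThm161Proofs` (`pastenShimura2024_thm_16_1_iff_h161`).
PROVED IN PRINT from Thm 6.1 (a), Jacquet–Langlands, Frey's identity, Mazur–Kenku, Mai–Murty,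
Thm 14.1 and Cor 10.2 (proof p. 49); typed, not proved, here.
[cite: PastenShimura2024, Theorem 16.1 (§16.1, arXiv:1705.09251v4 p. 49)] -/
def pastenShimura2024_thm_16_1 : Prop :=
  ∀ (S : Finset ℕ) (ε : ℝ), 0 < ε → ∃ N₀ : ℕ, ∀ (W : WeierstrassCurve ℚ) [W.IsElliptic],
    (∀ p : ℕ, p.Prime → p ∉ S → ¬ p ^ 2 ∣ W.conductorNorm ℤ) → N₀ ≤ W.conductorNorm ℤ →
      ∀ D M : ℕ, IsAdmissibleFactorization (W.conductorNorm ℤ) D M →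
        (∀ p ∈ D.primeFactors, p ∉ S) →
          ((∏ p ∈ D.primeFactors, (W.minimalDiscriminantNorm ℤ).factorization p : ℕ) : ℝ) <
            (W.conductorNorm ℤ : ℝ) ^ ((11 : ℝ) / 3 + ε)

/-- **The typed Theorem 16.1 is equivalent to the tree's inline hypothesis `h161`** (of
`pasten_cor_16_2_of_thm_16_1`, `pasten_thm_1_15_of_thm_16_1`): admissible `N = DM` with
`N = N_E` is the same as "`D ∣ N_E`, `gcd(D, N_E/D) = 1`, `D` squarefree, `ω(D)` even" with
`M = N_E/D`. [cite: PastenShimura2024, Theorem 16.1 (§16.1, arXiv:1705.09251v4 p. 49)] -/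
theorem pastenShimura2024_thm_16_1_iff_h161 :
    pastenShimura2024_thm_16_1 ↔
      ∀ (S : Finset ℕ) (ε : ℝ), 0 < ε → ∃ N₁ : ℕ, ∀ (W : WeierstrassCurve ℚ) [W.IsElliptic],
        (∀ p : ℕ, p.Prime → p ∉ S → ¬ p ^ 2 ∣ W.conductorNorm ℤ) → N₁ ≤ W.conductorNorm ℤ →
          ∀ D : ℕ, D ∣ W.conductorNorm ℤ → D.Coprime (W.conductorNorm ℤ / D) → Squarefree D →
            Even D.primeFactors.card → (∀ p ∈ D.primeFactors, p ∉ S) →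
              ((∏ p ∈ D.primeFactors, (W.minimalDiscriminantNorm ℤ).factorization p : ℕ) : ℝ)
                < (W.conductorNorm ℤ : ℝ) ^ (11 / 3 + ε : ℝ) := by
  constructor
  · intro h S ε hε
    obtain ⟨N₀, hN₀⟩ := h S ε hε
    refine ⟨N₀, fun W _ hS hle D hD hcop hsq heven hDS => ?_⟩
    exact hN₀ W hS hle D _ (isAdmissibleFactorization_div W.conductorNorm_pos_holds hD hcop hsq heven)
      hDS
  · intro h S ε hε
    obtain ⟨N₁, hN₁⟩ := h S ε hε
    refine ⟨N₁, fun W _ hS hle D M hadm hDS => ?_⟩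
    have hcop : D.Coprime (W.conductorNorm ℤ / D) := hadm.right_eq_div ▸ hadm.coprime
    exact hN₁ W hS hle D hadm.left_dvd hcop hadm.squarefree hadm.even_card_primeFactors hDS

/-- Projection of the typed Theorem 16.1 onto the inline hypothesis `h161`. [cite: PastenShimura2024, Theorem 16.1 (§16.1, arXiv:1705.09251v4 p. 49)] -/
theorem pastenShimura2024_thm_16_1.h161 (h : pastenShimura2024_thm_16_1) :
    ∀ (S : Finset ℕ) (ε : ℝ), 0 < ε → ∃ N₁ : ℕ, ∀ (W : WeierstrassCurve ℚ) [W.IsElliptic],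
      (∀ p : ℕ, p.Prime → p ∉ S → ¬ p ^ 2 ∣ W.conductorNorm ℤ) → N₁ ≤ W.conductorNorm ℤ →
        ∀ D : ℕ, D ∣ W.conductorNorm ℤ → D.Coprime (W.conductorNorm ℤ / D) → Squarefree D →
          Even D.primeFactors.card → (∀ p ∈ D.primeFactors, p ∉ S) →
            ((∏ p ∈ D.primeFactors, (W.minimalDiscriminantNorm ℤ).factorization p : ℕ) : ℝ)
              < (W.conductorNorm ℤ : ℝ) ^ (11 / 3 + ε : ℝ) :=
  pastenShimura2024_thm_16_1_iff_h161.mp h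

/-! ### Theorem 16.4 -/

/-- NAMED FACT — **Pasten, J. Number Theory 254 (2024), Theorem 16.4** (arXiv:1705.09251v4 §16.2,
p. 50, "A sharpening of the general estimate"). Printed statement: "Let `ε > 0`. Let `E` be an
elliptic curve over `ℚ` of conductor `N ≫_ε 1`. Let `N = DM` be an admissible factorization and
suppose that either (i) `E` is semi-stable and `M` is not a prime number, or (ii) `E` is a
Frey–Hellegouarch elliptic curve and `M` is divisible by at least two odd primes. Then we have
`∏_{p ∣ D} v_p(Δ) < N^{8/3 + ε} M`." (`Δ` = the minimal discriminant of `E`.) Rendering (module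
docstring): `E` = any elliptic `W/ℚ`; "`N ≫_ε 1`" = a threshold `N_E ≥ N₀(ε)`; admissible =
`IsAdmissibleFactorization N_E D M`; (i) = `W.IsSemistable ℤ ∧ ¬ M.Prime` (so `M = 1` is allowed,
as in print and as used in the proof of Thm 16.5: "`D = N` and `M = 1`"); (ii) =
`IsFreyHellegouarch W ∧ 2 ≤ #(M.primeFactors ∖ {2})` — both literally the classes (b.1)/(b.2) of
the tree's `PastenShimura2024_thm_6_1_b`; `v_p(Δ)` = exponent of `p` in `|Δ_min|`. Case (i)
projects onto the inline hypotheses `h164` of the Thm 16.5 proof files (`.isSemistable`,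
`.squarefree`); case (ii) (`.freyHellegouarch`) is the input of the `abc` bound Thm 16.7 =
`pasten2024_thm_2_5`. PROVED IN PRINT ("essentially the same as for Theorem 16.1 with the only
difference that we use Item (b) instead of Item (a) from Theorem 6.1", p. 50); typed, not proved,
here. [cite: PastenShimura2024, Theorem 16.4 (§16.2, arXiv:1705.09251v4 p. 50)] -/
def pastenShimura2024_thm_16_4 : Prop :=
  ∀ ε : ℝ, 0 < ε → ∃ N₀ : ℕ, ∀ (W : WeierstrassCurve ℚ) [W.IsElliptic],
    N₀ ≤ W.conductorNorm ℤ →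
      ∀ D M : ℕ, IsAdmissibleFactorization (W.conductorNorm ℤ) D M →
        (W.IsSemistable ℤ ∧ ¬ M.Prime) ∨
          (IsFreyHellegouarch W ∧ 2 ≤ (M.primeFactors.erase 2).card) →
          ((∏ p ∈ D.primeFactors, (W.minimalDiscriminantNorm ℤ).factorization p : ℕ) : ℝ) <
            (W.conductorNorm ℤ : ℝ) ^ ((8 : ℝ) / 3 + ε) * (M : ℝ)

/-- **Theorem 16.4 (i), `IsSemistable` phrasing**: the projection of the typed fact onto the inline
hypothesis `h164` of `PastenValuationProductsManyPrimesProofs` (semi-stable `E`, `N_E ≥ N₀(ε)`,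
`1 < D ∣ N_E` with `ω(D)` even, `M = N_E/D` not prime). For semi-stable `E` the conductor is
squarefree (`isSemistable_iff_squarefree_conductorNorm`), so every such `D` is admissible.
[cite: PastenShimura2024, Theorem 16.4 (i) (§16.2, arXiv:1705.09251v4 p. 50)] -/
theorem pastenShimura2024_thm_16_4.isSemistable (h : pastenShimura2024_thm_16_4) :
    ∀ ε : ℝ, 0 < ε → ∃ N₀ : ℕ, ∀ (W : WeierstrassCurve ℚ) [W.IsElliptic],
      W.IsSemistable ℤ → N₀ ≤ W.conductorNorm ℤ →
        ∀ D : ℕ, 1 < D → D ∣ W.conductorNorm ℤ → Even D.primeFactors.card →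
          ¬ (W.conductorNorm ℤ / D).Prime →
            ((∏ p ∈ D.primeFactors, (W.minimalDiscriminantNorm ℤ).factorization p : ℕ) : ℝ)
              < (W.conductorNorm ℤ : ℝ) ^ ((8 : ℝ) / 3 + ε) * ((W.conductorNorm ℤ / D : ℕ) : ℝ) := by
  intro ε hε
  obtain ⟨N₀, hN₀⟩ := h ε hε
  refine ⟨N₀, fun W _ hss hle D _ hD heven hnp => ?_⟩
  exact hN₀ W hle D _ (isAdmissibleFactorization_div_of_squarefree
    ((W.isSemistable_iff_squarefree_conductorNorm).mp hss) hD heven) (Or.inl ⟨hss, hnp⟩)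

/-- **Theorem 16.4 (i), `Squarefree` phrasing**: the projection of the typed fact onto the inline
hypothesis `h164` of `ValuationProductEllipticManyPrimesProofs` / `PastenValuationProductStrict`
(semi-stability as `Squarefree N_E`). [cite: PastenShimura2024, Theorem 16.4 (i) (§16.2, arXiv:1705.09251v4 p. 50)] -/
theorem pastenShimura2024_thm_16_4.squarefree (h : pastenShimura2024_thm_16_4) :
    ∀ ε : ℝ, 0 < ε → ∃ N₀ : ℕ, ∀ (W : WeierstrassCurve ℚ) [W.IsElliptic],
      Squarefree (W.conductorNorm ℤ) → N₀ ≤ W.conductorNorm ℤ →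
        ∀ D : ℕ, 1 < D → D ∣ W.conductorNorm ℤ → Even D.primeFactors.card →
          ¬ (W.conductorNorm ℤ / D).Prime →
            ((∏ p ∈ D.primeFactors, (W.minimalDiscriminantNorm ℤ).factorization p : ℕ) : ℝ)
              < (W.conductorNorm ℤ : ℝ) ^ (8 / 3 + ε : ℝ) * ((W.conductorNorm ℤ / D : ℕ) : ℝ) := by
  intro ε hε
  obtain ⟨N₀, hN₀⟩ := h.isSemistable ε hε
  exact ⟨N₀, fun W _ hsq hle => hN₀ W ((W.isSemistable_iff_squarefree_conductorNorm).mpr hsq) hle⟩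

/-- **Theorem 16.4 (ii)** (Frey–Hellegouarch curves, `M` divisible by at least two odd primes):
the projection consumed by the proof of the `abc` bound Thm 16.7.
[cite: PastenShimura2024, Theorem 16.4 (ii) (§16.2, arXiv:1705.09251v4 p. 50)] -/
theorem pastenShimura2024_thm_16_4.freyHellegouarch (h : pastenShimura2024_thm_16_4) :
    ∀ ε : ℝ, 0 < ε → ∃ N₀ : ℕ, ∀ (W : WeierstrassCurve ℚ) [W.IsElliptic],
      IsFreyHellegouarch W → N₀ ≤ W.conductorNorm ℤ →
        ∀ D M : ℕ, IsAdmissibleFactorization (W.conductorNorm ℤ) D M →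
          2 ≤ (M.primeFactors.erase 2).card →
            ((∏ p ∈ D.primeFactors, (W.minimalDiscriminantNorm ℤ).factorization p : ℕ) : ℝ)
              < (W.conductorNorm ℤ : ℝ) ^ ((8 : ℝ) / 3 + ε) * (M : ℝ) := by
  intro ε hε
  obtain ⟨N₀, hN₀⟩ := h ε hε
  exact ⟨N₀, fun W _ hFH hle D M hadm hM => hN₀ W hle D M hadm (Or.inr ⟨hFH, hM⟩)⟩

/-! ### The consumers, fed by name -/

/-- **Corollary 16.2** (the tree's named fact `Literature.NumberTheory.EllipticCurves.pasten_cor_16_2`)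
**from Theorem 16.1**: the printed proof (`pasten_cor_16_2_of_thm_16_1`, the `(n-1)`-st-root device)
fed with the typed fact. [cite: PastenShimura2024, Corollary 16.2 with its proof (arXiv:1705.09251v4 p. 49)] -/
theorem pasten_cor_16_2_of_pastenShimura2024_thm_16_1 (h : pastenShimura2024_thm_16_1) :
    Literature.NumberTheory.EllipticCurves.pasten_cor_16_2 :=
  Literature.NumberTheory.EllipticCurves.pasten_cor_16_2_of_thm_16_1 h.h161

/-- **Theorem 1.15** (Tamagawa numbers; the tree's named fact
`Literature.NumberTheory.EllipticCurves.pasten_thm_1_15`) **from Theorem 16.1** alone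
(`pasten_thm_1_15_of_thm_16_1` fed with the typed fact).
[cite: PastenShimura2024, Theorem 1.15 and Corollary 16.3 (arXiv:1705.09251v4 pp. 8, 50)] -/
theorem pasten_thm_1_15_of_pastenShimura2024_thm_16_1 (h : pastenShimura2024_thm_16_1) :
    Literature.NumberTheory.EllipticCurves.pasten_thm_1_15 :=
  Literature.NumberTheory.EllipticCurves.pasten_thm_1_15_of_thm_16_1 h.h161

/-- **Theorem 16.5, second part (strict form), from Theorem 1.12 and Theorem 16.4 (i)**
(`pasten_valuationProduct_semistable_manyPrimes_strict_of_thm_16_4` fed with the typed fact): for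
every `ε > 0` there is `K > 0` with `∏_{p ∣ N_E} v_p(Δ_E) < K · N_E^{8/3+ε}` for every semi-stable
`E/ℚ` with more than `3 + 11/ε` places of bad reduction.
[cite: PastenShimura2024, Theorem 16.5 (arXiv numbering) second part with its proof (p. 50)] -/
theorem pasten_valuationProduct_semistable_manyPrimes_strict_of_pastenShimura2024_thm_16_4
    (h112 : pasten_valuationProduct_semistable) (h : pastenShimura2024_thm_16_4) :
    ∀ ε : ℝ, 0 < ε → ∃ K : ℝ, 0 < K ∧ ∀ (W : WeierstrassCurve ℚ) [W.IsElliptic],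
      W.IsSemistable ℤ → (3 : ℝ) + 11 / ε < ((W.conductorNorm ℤ).primeFactors.card : ℝ) →
        (valuationProduct W : ℝ) < K * (W.conductorNorm ℤ : ℝ) ^ ((8 : ℝ) / 3 + ε) :=
  pasten_valuationProduct_semistable_manyPrimes_strict_of_thm_16_4 h112 h.isSemistable

/-- **Theorem 1.12 / 16.5 in the corrected form `S` of `PastenValuationProductStrict`, from
Theorem 16.1, Mestre–Oesterlé and Theorem 16.4 (i)** (`pasten_thm_1_12_strict_of_thm_16_4` fed with
Corollary 16.2 ⇐ Theorem 16.1 and with the typed Theorem 16.4): the whole printed §16.3 hangs from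
the two typed theorems of §16.1–16.2 and `v_p(Δ_E) ≤ 5` at prime conductor.
[cite: PastenShimura2024, Theorems 1.12, 16.1, 16.4, 16.5 (arXiv numbering, pp. 8, 49–50)] -/
theorem pasten_thm_1_12_strict_of_pastenShimura2024_thm_16_1_16_4 (h161 : pastenShimura2024_thm_16_1)
    (h₂ : Literature.NumberTheory.EllipticCurves.mestreOesterle_factorization_le_five)
    (h164 : pastenShimura2024_thm_16_4) :
    ∀ ε : ℝ, 0 < ε → ∃ K : ℝ, 0 < K ∧
      (∀ (W : WeierstrassCurve ℚ) [W.IsElliptic], W.IsSemistable ℤ →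
        ((∏ p ∈ (W.conductorNorm ℤ).primeFactors,
            (W.minimalDiscriminantNorm ℤ).factorization p : ℕ) : ℝ)
          < K * (W.conductorNorm ℤ : ℝ) ^ (11 / 2 + ε : ℝ)) ∧
      (∀ (W : WeierstrassCurve ℚ) [W.IsElliptic], W.IsSemistable ℤ →
        (3 : ℝ) + 11 / ε < ((W.conductorNorm ℤ).primeFactors.card : ℝ) →
          ((∏ p ∈ (W.conductorNorm ℤ).primeFactors,
              (W.minimalDiscriminantNorm ℤ).factorization p : ℕ) : ℝ)
            < K * (W.conductorNorm ℤ : ℝ) ^ (8 / 3 + ε : ℝ)) :=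
  Literature.NumberTheory.EllipticCurves.pasten_thm_1_12_strict_of_thm_16_4
    (pasten_cor_16_2_of_pastenShimura2024_thm_16_1 h161) h₂ h164.squarefree

end Literature.NumberTheory.DiophantineGeometry

end
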